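import Mathlib.Analysis.Calculus.BumpFunction.Normed
import Mathlib.MeasureTheory.Function.L2Space
import Literature.Analysis.FluidPDE.BiotSavartCurlPair
import Literature.Analysis.FluidPDE.PoincareHomotopyOperatorL2
import Literature.Analysis.FluidPDE.StretchingRate
import HarnessLib

/-!
# Weak limits of asymptotically aligned vorticities — tools (weak convergence of curls, reference
# directions, the mass bound)

Cell `ns-blowup`, seat `ns-blowup-ecbridge-2` (g10; the E–C endpoint theory seat). LABEL: E–C typing
(KERNEL — pure analysis, no named fact). WHAT THIS IS NOT: not Navier–Stokes evidence — a compactness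
device (no equation is used). Companion memo: `run/shared/lean/pub/ns-blowup/ecbridge2/ECBRIDGE-2-MEMO-9.md`.

A device for Giga–Miura's continuous-alignment criterion (Y. Giga, H. Miura, Comm. Math. Phys. 303
(2011), Prop. 2.2: under (CA′) the blow-up limit of the near-maximum zooms has unidirectional
vorticity `ω̄(x,t) = |ω̄(x,t)| ζ₀(t)`). In print — and in the tree's unforced discharge
`gigaMiura2011_scaledAlignment_blowupLimit_curl_eq_zero_holds` — the direction field passes to the
limit because the zooms converge WITH THEIR DERIVATIVES (KNSS 2009 §4 smoothing of bounded mild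
solutions). For zooms that are only PERTURBED Oseen-mild (a blow-up carrying a force — the (C) type,
`ClayBlowup.exists_zoom_limit`) no such `C¹` compactness is in the tree; the sibling file
`AlignedVorticityWeakLimit.lean` shows that NONE IS NEEDED. This file holds the tools:

* `tendsto_integral_inner_curl_of_tendsto`, `tendsto_integral_smul_curl_of_tendsto` — if `w_j → V`
  pointwise with `‖w_j‖ ≤ K` (`C¹` fields), then `∫⟪curl w_j, Ψ⟫ → ∫⟪curl V, Ψ⟫` for `C¹`
  compactly supported `Ψ`, and `∫ψ curl w_j → ∫ψ curl V` (integration by parts + dominated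
  convergence);
* `exists_refDirection_of_aligned` — if the directions of `ω` at the points of `S` where `|ω| > d`
  are pairwise `ε`-close, some `e`, `‖e‖ ≤ 1`, has `‖ω − |ω| e‖ ≤ ε|ω| + 2d` and
  `|ω| ≤ |ω|‖e‖ + d` on `S`; integrated forms `norm_integral_smul_sub_mass_smul_le`,
  `mass_le_of_refDirection`; the algebra `inner_ge_of_near_parallel`;
* `norm_integral_smul_curl_le` — THE MASS BOUND `‖∫ψ curl u‖ ≤ K ∫‖Dψ‖` for `‖u‖ ≤ K` (test against
  `ψ` times the vector itself and integrate by parts onto `u`).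

References: Y. Giga, H. Miura, Comm. Math. Phys. 303 (2011) 289–300, §2.1 [cite: GigaMiura2011,
§2.1 Prop. 2.2]; P. Constantin, C. Fefferman, Indiana Univ. Math. J. 42 (1993), §1
[cite: ConstantinFefferman1993, §1].
-/

noncomputable section

namespace Summit.NavierStokesRegularity.FluidComputer

open MeasureTheory Set Function Filter Metric Topology
open scoped InnerProductSpace RealInnerProductSpace
open Literature.Analysis Literature.Analysis.FluidPDE

/-! ### Finite-dimensional bookkeeping -/

/-- In `(EuclideanSpace ℝ (Fin 3))`, convergence of all inner products `⟪v, A_j⟫ → ⟪v, a⟫` implies `A_j → a`. [folklore] -/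
theorem tendsto_of_forall_inner_tendsto {A : ℕ → (EuclideanSpace ℝ (Fin 3))} {a : (EuclideanSpace ℝ (Fin 3))}
    (h : ∀ v : (EuclideanSpace ℝ (Fin 3)), Tendsto (fun j => ⟪v, A j⟫) atTop (𝓝 ⟪v, a⟫)) : Tendsto A atTop (𝓝 a) := by
  have hi : ∀ i : Fin 3, Tendsto (fun j => A j i) atTop (𝓝 (a i)) := fun i => by
    simpa [EuclideanSpace.inner_single_left] using h (EuclideanSpace.single i (1 : ℝ))
  rw [tendsto_iff_dist_tendsto_zero]
  have hsum : Tendsto (fun j => Real.sqrt (∑ i, dist (A j i) (a i) ^ 2)) atTop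
      (𝓝 (Real.sqrt (∑ i : Fin 3, dist (a i) (a i) ^ 2))) :=
    (tendsto_finsetSum _ fun i _ => ((hi i).dist tendsto_const_nhds).pow 2).sqrt
  simp only [dist_self, ne_eq, OfNat.ofNat_ne_zero, not_false_eq_true, zero_pow,
    Finset.sum_const_zero, Real.sqrt_zero] at hsum
  refine hsum.congr fun j => ?_
  rw [EuclideanSpace.dist_eq]

/-- Equality in Cauchy–Schwarz for all pairs of values makes a field unidirectional:
if `⟪Ω y, Ω y'⟫ = ‖Ω y‖ ‖Ω y'‖` for all `y, y'`, then `Ω = |Ω| ζ₀` for one vector `ζ₀`. [folklore] -/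
theorem exists_eq_norm_smul_of_forall_inner_eq {Ω : (EuclideanSpace ℝ (Fin 3)) → (EuclideanSpace ℝ (Fin 3))}
    (h : ∀ y y', ⟪Ω y, Ω y'⟫ = ‖Ω y‖ * ‖Ω y'‖) : ∃ ζ₀ : (EuclideanSpace ℝ (Fin 3)), ∀ y, Ω y = ‖Ω y‖ • ζ₀ := by
  by_cases hz : ∀ y, Ω y = 0
  · exact ⟨0, fun y => by rw [hz y, norm_zero, zero_smul]⟩
  push Not at hz
  obtain ⟨y₀, hy₀⟩ := hz
  have hn : ‖Ω y₀‖ ≠ 0 := norm_ne_zero_iff.2 hy₀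
  refine ⟨‖Ω y₀‖⁻¹ • Ω y₀, fun y => ?_⟩
  have key : ‖Ω y₀‖ • Ω y = ‖Ω y‖ • Ω y₀ := (inner_eq_norm_mul_iff_real).1 (h y y₀)
  rw [smul_smul, mul_comm, ← smul_smul, ← key, smul_smul, inv_mul_cancel₀ hn, one_smul]

/-! ### Weak convergence of the curls -/

section Weak

variable {w : ℕ → (EuclideanSpace ℝ (Fin 3)) → (EuclideanSpace ℝ (Fin 3))} {V : (EuclideanSpace ℝ (Fin 3)) → (EuclideanSpace ℝ (Fin 3))} {K : ℝ}

/-- **Pointwise bounded convergence of `C¹` fields gives weak convergence of their curls**: if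
`w_j → V` pointwise (eventually `C¹`, eventually bounded by `K`) and `V ∈ C¹`, then
`∫⟪curl w_j, Ψ⟫ → ∫⟪curl V, Ψ⟫` for every `C¹` field `Ψ` with compact support (move the curl onto
`Ψ`, `integral_inner_curl_eq_integral_inner_curl`, and use dominated convergence). [folklore] -/
theorem tendsto_integral_inner_curl_of_tendsto (hw : ∀ᶠ j in atTop, ContDiff ℝ 1 (w j))
    (hV : ContDiff ℝ 1 V) (hK : ∀ᶠ j in atTop, ∀ y, ‖w j y‖ ≤ K)
    (hconv : ∀ y, Tendsto (fun j => w j y) atTop (𝓝 (V y))) {Ψ : (EuclideanSpace ℝ (Fin 3)) → (EuclideanSpace ℝ (Fin 3))} (hΨ : ContDiff ℝ 1 Ψ)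
    (hΨc : HasCompactSupport Ψ) :
    Tendsto (fun j => ∫ y, ⟪curl (w j) y, Ψ y⟫) atTop (𝓝 (∫ y, ⟪curl V y, Ψ y⟫)) := by
  rw [integral_inner_curl_eq_integral_inner_curl hV hΨ hΨc]
  have heq : (fun j => ∫ y, ⟪w j y, curl Ψ y⟫) =ᶠ[atTop] fun j => ∫ y, ⟪curl (w j) y, Ψ y⟫ := by
    filter_upwards [hw] with j hj
    rw [integral_inner_curl_eq_integral_inner_curl hj hΨ hΨc]
  refine Tendsto.congr' heq ?_
  have hcΨ : Continuous (curl Ψ) := continuous_curl hΨ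
  have hcΨs : HasCompactSupport (curl Ψ) := hasCompactSupport_curl hΨc
  refine tendsto_integral_filter_of_dominated_convergence (fun y => K * ‖curl Ψ y‖) ?_ ?_ ?_ ?_
  · filter_upwards [hw] with j hj
    exact (hj.continuous.inner hcΨ).aestronglyMeasurable
  · filter_upwards [hK] with j hj
    exact Eventually.of_forall fun y =>
      (norm_inner_le_norm _ _).trans (mul_le_mul_of_nonneg_right (hj y) (norm_nonneg _))
  · exact (hcΨ.norm.integrable_of_hasCompactSupport hcΨs.norm).const_mul K
  · exact Eventually.of_forall fun y => (hconv y).inner tendsto_const_nhds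

/-- **Weak convergence of the weighted vorticity vectors**: under the same hypotheses, for a `C¹`
compactly supported scalar weight `ψ`, `∫ ψ curl w_j → ∫ ψ curl V` in `(EuclideanSpace ℝ (Fin 3))` (test against `ψ v` for
each vector `v`). [folklore] -/
theorem tendsto_integral_smul_curl_of_tendsto (hw : ∀ᶠ j in atTop, ContDiff ℝ 1 (w j))
    (hV : ContDiff ℝ 1 V) (hK : ∀ᶠ j in atTop, ∀ y, ‖w j y‖ ≤ K)
    (hconv : ∀ y, Tendsto (fun j => w j y) atTop (𝓝 (V y))) {ψ : (EuclideanSpace ℝ (Fin 3)) → ℝ} (hψ : ContDiff ℝ 1 ψ)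
    (hψc : HasCompactSupport ψ) :
    Tendsto (fun j => ∫ y, ψ y • curl (w j) y) atTop (𝓝 (∫ y, ψ y • curl V y)) := by
  -- integrability of the weighted curls (continuous with compact support), eventually
  have hint : ∀ {u : (EuclideanSpace ℝ (Fin 3)) → (EuclideanSpace ℝ (Fin 3))}, ContDiff ℝ 1 u → Integrable (fun y => ψ y • curl u y) := by
    intro u hu
    have hcs : HasCompactSupport (fun y => ψ y • curl u y) := hψc.smul_right (f' := curl u)
    exact (hψ.continuous.smul (continuous_curl hu)).integrable_of_hasCompactSupport hcs
  refine tendsto_of_forall_inner_tendsto fun v => ?_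
  have hΨ : ContDiff ℝ 1 (fun y => ψ y • v) := hψ.smul contDiff_const
  have hΨc : HasCompactSupport (fun y => ψ y • v) := hψc.smul_right (f' := fun _ => v)
  have h := tendsto_integral_inner_curl_of_tendsto hw hV hK hconv hΨ hΨc
  have e : ∀ {u : (EuclideanSpace ℝ (Fin 3)) → (EuclideanSpace ℝ (Fin 3))}, ContDiff ℝ 1 u →
      ∫ y, ⟪curl u y, ψ y • v⟫ = ⟪v, ∫ y, ψ y • curl u y⟫ := fun hu => by
    rw [← integral_inner (hint hu) v]
    refine integral_congr_ae (Eventually.of_forall fun y => ?_)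
    simp only [real_inner_smul_right, real_inner_smul_right, real_inner_comm]
  rw [e hV] at h
  refine h.congr' ?_
  filter_upwards [hw] with j hj
  rw [e hj]

end Weak

/-! ### A reference direction for an aligned vorticity field -/

section Aligned

variable {ω : (EuclideanSpace ℝ (Fin 3)) → (EuclideanSpace ℝ (Fin 3))} {S : Set (EuclideanSpace ℝ (Fin 3))} {ε d : ℝ}

/-- `ω = |ω| ξ` at points where `ω ≠ 0`. [cite: ConstantinFefferman1993, §1] -/
theorem norm_smul_vorticityDirection_of_ne (ω : (EuclideanSpace ℝ (Fin 3)) → (EuclideanSpace ℝ (Fin 3))) {x : (EuclideanSpace ℝ (Fin 3))} (hx : ω x ≠ 0) :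
    ‖ω x‖ • vorticityDirection ω x = ω x := by
  rw [vorticityDirection, smul_smul, mul_inv_cancel₀ (norm_ne_zero_iff.2 hx), one_smul]

/-- **A reference direction**: if on `S` the directions `ξ = ω/|ω|` at any two points with `|ω| > d`
(`d ≥ 0`) differ by at most `ε ≥ 0`, then some `e` with `‖e‖ ≤ 1` has `‖ω(y) − |ω(y)| e‖ ≤ ε|ω(y)| + 2d`
and `|ω(y)| ≤ |ω(y)| ‖e‖ + d` for all `y ∈ S` (`e = ξ(p)` for any `p ∈ S` above the threshold, else
`e = 0`). [folklore] -/
theorem exists_refDirection_of_aligned (hε : 0 ≤ ε) (hd : 0 ≤ d)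
    (halign : ∀ y ∈ S, ∀ y' ∈ S, d < ‖ω y‖ → d < ‖ω y'‖ →
      ‖vorticityDirection ω y - vorticityDirection ω y'‖ ≤ ε) :
    ∃ e : (EuclideanSpace ℝ (Fin 3)), ‖e‖ ≤ 1 ∧ (∀ y ∈ S, ‖ω y‖ ≤ ‖ω y‖ * ‖e‖ + d) ∧
      ∀ y ∈ S, ‖ω y - ‖ω y‖ • e‖ ≤ ε * ‖ω y‖ + 2 * d := by
  by_cases hp : ∃ p ∈ S, d < ‖ω p‖
  · obtain ⟨p, hpS, hpd⟩ := hp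
    have hp0 : ω p ≠ 0 := fun h => by rw [h, norm_zero] at hpd; linarith
    refine ⟨vorticityDirection ω p, (norm_vorticityDirection ω hp0).le, fun y _ => by
      rw [norm_vorticityDirection ω hp0, mul_one]; linarith, fun y hy => ?_⟩
    by_cases hyd : d < ‖ω y‖
    · have hy0 : ω y ≠ 0 := fun h => by rw [h, norm_zero] at hyd; linarith
      have e1 : ω y - ‖ω y‖ • vorticityDirection ω p =
          ‖ω y‖ • (vorticityDirection ω y - vorticityDirection ω p) := by
        rw [smul_sub, norm_smul_vorticityDirection_of_ne ω hy0]
      rw [e1, norm_smul, norm_norm, mul_comm]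
      have h := halign y hy p hpS hyd hpd
      nlinarith [norm_nonneg (ω y), norm_nonneg (vorticityDirection ω y - vorticityDirection ω p)]
    · rw [not_lt] at hyd
      calc ‖ω y - ‖ω y‖ • vorticityDirection ω p‖
          ≤ ‖ω y‖ + ‖‖ω y‖ • vorticityDirection ω p‖ := norm_sub_le _ _
        _ ≤ ‖ω y‖ + ‖ω y‖ * 1 := by
            rw [norm_smul, norm_norm]
            gcongr
            exact (norm_vorticityDirection ω hp0).le
        _ ≤ ε * ‖ω y‖ + 2 * d := by nlinarith [norm_nonneg (ω y)]
  · push Not at hp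
    refine ⟨0, by simp, fun y hy => by rw [norm_zero, mul_zero, zero_add]; exact hp y hy,
      fun y hy => ?_⟩
    rw [smul_zero, sub_zero]
    nlinarith [hp y hy, norm_nonneg (ω y)]

variable {ψ : (EuclideanSpace ℝ (Fin 3)) → ℝ}

/-- **The weighted vorticity vector is within `ε m + 2 d ∫ψ` of `m e`**, `m = ∫ψ|ω|`, for a
non-negative continuous compactly supported weight `ψ` supported in `S` and a reference direction `e`
as in `exists_refDirection_of_aligned`. [folklore] -/
theorem norm_integral_smul_sub_mass_smul_le (hω : Continuous ω) (hψc : Continuous ψ)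
    (hψs : HasCompactSupport ψ) (hψ0 : ∀ y, 0 ≤ ψ y) (hsupp : support ψ ⊆ S) {e : (EuclideanSpace ℝ (Fin 3))}
    (he : ∀ y ∈ S, ‖ω y - ‖ω y‖ • e‖ ≤ ε * ‖ω y‖ + 2 * d) :
    ‖(∫ y, ψ y • ω y) - (∫ y, ψ y * ‖ω y‖) • e‖ ≤
      ε * (∫ y, ψ y * ‖ω y‖) + 2 * d * ∫ y, ψ y := by
  have hi1 : Integrable (fun y => ψ y • ω y) := (hψc.smul hω).integrable_of_hasCompactSupport hψs.smul_right
  have hi2 : Integrable (fun y => ψ y * ‖ω y‖) :=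
    (hψc.mul hω.norm).integrable_of_hasCompactSupport hψs.mul_right
  have hi3 : Integrable ψ := hψc.integrable_of_hasCompactSupport hψs
  have hi4 : Integrable (fun y => (ψ y * ‖ω y‖) • e) := hi2.smul_const e
  rw [← integral_smul_const, ← integral_sub hi1 hi4]
  have hpt : ∀ y, ‖ψ y • ω y - (ψ y * ‖ω y‖) • e‖ ≤ ε * (ψ y * ‖ω y‖) + 2 * d * ψ y := by
    intro y
    by_cases hy : y ∈ support ψ
    · have e1 : ψ y • ω y - (ψ y * ‖ω y‖) • e = ψ y • (ω y - ‖ω y‖ • e) := by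
        rw [smul_sub, smul_smul]
      rw [e1, norm_smul, Real.norm_of_nonneg (hψ0 y)]
      have h := he y (hsupp hy)
      nlinarith [hψ0 y]
    · rw [notMem_support] at hy
      simp [hy]
  calc ‖∫ y, (ψ y • ω y - (ψ y * ‖ω y‖) • e)‖
      ≤ ∫ y, ‖ψ y • ω y - (ψ y * ‖ω y‖) • e‖ := norm_integral_le_integral_norm _
    _ ≤ ∫ y, (ε * (ψ y * ‖ω y‖) + 2 * d * ψ y) := by
        refine integral_mono_of_nonneg (Eventually.of_forall fun y => norm_nonneg _)
          ((hi2.const_mul ε).add (hi3.const_mul (2 * d))) (Eventually.of_forall hpt)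
    _ = ε * (∫ y, ψ y * ‖ω y‖) + 2 * d * ∫ y, ψ y := by
        rw [integral_add (hi2.const_mul ε) (hi3.const_mul (2 * d)), integral_const_mul,
          integral_const_mul]

/-- The norm of the weighted vorticity vector is at most its mass: `‖∫ψ ω‖ ≤ ∫ψ|ω|`. [folklore] -/
theorem norm_integral_smul_le_mass (hψ0 : ∀ y, 0 ≤ ψ y) :
    ‖∫ y, ψ y • ω y‖ ≤ ∫ y, ψ y * ‖ω y‖ := by
  refine (norm_integral_le_integral_norm _).trans (le_of_eq ?_)
  refine integral_congr_ae (Eventually.of_forall fun y => ?_)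
  simp only [norm_smul, Real.norm_of_nonneg (hψ0 y)]

/-- **Near-parallelism of the weighted vorticity vectors**: with a reference direction `e`,
`‖e‖ ≤ 1`, masses `mᵢ = ∫ψᵢ|ω|` and defects `‖Aᵢ − mᵢ e‖ ≤ δᵢ`, the vectors `Aᵢ = ∫ψᵢ ω` satisfy
`‖A₁‖‖A₂‖ − 2(m₁δ₂ + m₂δ₁ + δ₁δ₂) ≤ ⟪A₁, A₂⟫` (pure inner-product algebra, given `‖Aᵢ‖ ≤ mᵢ`).
[folklore] -/
theorem inner_ge_of_near_parallel {A₁ A₂ e : (EuclideanSpace ℝ (Fin 3))} {m₁ m₂ δ₁ δ₂ : ℝ} (he : ‖e‖ ≤ 1)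
    (hm₁ : ‖A₁‖ ≤ m₁) (hm₂ : ‖A₂‖ ≤ m₂) (hδ₁ : ‖A₁ - m₁ • e‖ ≤ δ₁) (hδ₂ : ‖A₂ - m₂ • e‖ ≤ δ₂) :
    ‖A₁‖ * ‖A₂‖ - 2 * (m₁ * δ₂ + m₂ * δ₁ + δ₁ * δ₂) ≤ ⟪A₁, A₂⟫ := by
  set D₁ : (EuclideanSpace ℝ (Fin 3)) := A₁ - m₁ • e with hD₁
  set D₂ : (EuclideanSpace ℝ (Fin 3)) := A₂ - m₂ • e with hD₂
  have hA₁ : A₁ = m₁ • e + D₁ := by rw [hD₁]; abel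
  have hA₂ : A₂ = m₂ • e + D₂ := by rw [hD₂]; abel
  have hm₁0 : 0 ≤ m₁ := (norm_nonneg _).trans hm₁
  have hm₂0 : 0 ≤ m₂ := (norm_nonneg _).trans hm₂
  have hδ₁0 : 0 ≤ δ₁ := (norm_nonneg _).trans hδ₁
  have hδ₂0 : 0 ≤ δ₂ := (norm_nonneg _).trans hδ₂
  have he0 : 0 ≤ ‖e‖ := norm_nonneg _
  -- the inner product
  have h1 : ⟪A₁, A₂⟫ = m₁ * m₂ * ‖e‖ ^ 2 + m₁ * ⟪e, D₂⟫ + m₂ * ⟪D₁, e⟫ + ⟪D₁, D₂⟫ := by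
    rw [hA₁, hA₂, inner_add_left, inner_add_right, inner_add_right, real_inner_smul_left,
      real_inner_smul_left, real_inner_smul_right, real_inner_smul_right, real_inner_self_eq_norm_sq]
    ring
  have h2 : |⟪e, D₂⟫| ≤ δ₂ := (abs_real_inner_le_norm _ _).trans (by nlinarith [norm_nonneg D₂])
  have h3 : |⟪D₁, e⟫| ≤ δ₁ := (abs_real_inner_le_norm _ _).trans (by nlinarith [norm_nonneg D₁])
  have h4 : |⟪D₁, D₂⟫| ≤ δ₁ * δ₂ :=
    (abs_real_inner_le_norm _ _).trans (mul_le_mul hδ₁ hδ₂ (norm_nonneg _) hδ₁0)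
  -- the norms
  have h5 : ‖A₁‖ ≤ m₁ * ‖e‖ + δ₁ := by
    rw [hA₁]
    calc ‖m₁ • e + D₁‖ ≤ ‖m₁ • e‖ + ‖D₁‖ := norm_add_le _ _
      _ ≤ m₁ * ‖e‖ + δ₁ := by rw [norm_smul, Real.norm_of_nonneg hm₁0]; gcongr
  have h6 : ‖A₂‖ ≤ m₂ * ‖e‖ + δ₂ := by
    rw [hA₂]
    calc ‖m₂ • e + D₂‖ ≤ ‖m₂ • e‖ + ‖D₂‖ := norm_add_le _ _
      _ ≤ m₂ * ‖e‖ + δ₂ := by rw [norm_smul, Real.norm_of_nonneg hm₂0]; gcongr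
  have h7 : ‖A₁‖ * ‖A₂‖ ≤ (m₁ * ‖e‖ + δ₁) * (m₂ * ‖e‖ + δ₂) :=
    mul_le_mul h5 h6 (norm_nonneg _) (by positivity)
  rw [h1]
  have h8 := abs_le.1 h2
  have h9 := abs_le.1 h3
  have h10 := abs_le.1 h4
  nlinarith [mul_nonneg hm₁0 hδ₂0, mul_nonneg hm₂0 hδ₁0, mul_nonneg hδ₁0 hδ₂0,
    mul_nonneg (mul_nonneg hm₁0 hm₂0) (mul_nonneg he0 (sub_nonneg.2 he)),
    mul_nonneg (mul_nonneg hm₁0 hδ₂0) (sub_nonneg.2 he), mul_nonneg (mul_nonneg hm₂0 hδ₁0) (sub_nonneg.2 he)]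

end Aligned

/-! ### The mass bound by integration by parts -/

section Mass

variable {u : (EuclideanSpace ℝ (Fin 3)) → (EuclideanSpace ℝ (Fin 3))} {ψ : (EuclideanSpace ℝ (Fin 3)) → ℝ} {K : ℝ}

/-- **The weighted vorticity vector is controlled by the velocity bound**: for `u ∈ C¹` with
`‖u‖ ≤ K` (`K ≥ 0`) and a `C¹` compactly supported weight `ψ`,
`‖∫ψ curl u‖ ≤ K ∫‖Dψ‖` — test against `ψ · A`, `A = ∫ψ curl u`, and move the curl:
`‖A‖² = ∫⟪u, ∇ψ × A⟫ ≤ K‖A‖∫‖∇ψ‖`. [folklore] -/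
theorem norm_integral_smul_curl_le (hu : ContDiff ℝ 1 u) (hK0 : 0 ≤ K) (hK : ∀ y, ‖u y‖ ≤ K)
    (hψ : ContDiff ℝ 1 ψ) (hψc : HasCompactSupport ψ) :
    ‖∫ y, ψ y • curl u y‖ ≤ K * ∫ y, ‖fderiv ℝ ψ y‖ := by
  set A : (EuclideanSpace ℝ (Fin 3)) := ∫ y, ψ y • curl u y with hA
  have hcs : HasCompactSupport (fun y => ψ y • curl u y) := hψc.smul_right (f' := curl u)
  have hint : Integrable (fun y => ψ y • curl u y) :=
    (hψ.continuous.smul (continuous_curl hu)).integrable_of_hasCompactSupport hcs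
  have hΨ : ContDiff ℝ 1 (fun y => ψ y • A) := hψ.smul contDiff_const
  have hΨc : HasCompactSupport (fun y => ψ y • A) := hψc.smul_right (f' := fun _ => A)
  have hgc : Continuous (fderiv ℝ ψ) := hψ.continuous_fderiv one_ne_zero
  have hgs : HasCompactSupport (fderiv ℝ ψ) := hψc.fderiv ℝ
  have hgi : Integrable (fun y => ‖fderiv ℝ ψ y‖) := hgc.norm.integrable_of_hasCompactSupport hgs.norm
  have hng : ∀ y, ‖gradient ψ y‖ = ‖fderiv ℝ ψ y‖ := fun y =>
    (InnerProductSpace.toDual ℝ (EuclideanSpace ℝ (Fin 3))).symm.norm_map _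
  -- `‖A‖² = ∫⟪curl u, ψ A⟫ = ∫⟪u, ∇ψ × A⟫`
  have h1 : ‖A‖ ^ 2 = ∫ y, ⟪u y, curl (fun y => ψ y • A) y⟫ := by
    rw [← integral_inner_curl_eq_integral_inner_curl hu hΨ hΨc, ← real_inner_self_eq_norm_sq, hA,
      ← integral_inner hint]
    refine integral_congr_ae (Eventually.of_forall fun y => ?_)
    simp only [real_inner_smul_right, real_inner_smul_left, real_inner_comm]
  have h2 : ∀ y, ‖⟪u y, curl (fun y => ψ y • A) y⟫‖ ≤ K * ‖A‖ * ‖fderiv ℝ ψ y‖ := by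
    intro y
    rw [curl_smul_const ((hψ.differentiable one_ne_zero) y) , ← hng y]
    calc ‖⟪u y, cross (gradient ψ y) A⟫‖ ≤ ‖u y‖ * ‖cross (gradient ψ y) A‖ := norm_inner_le_norm _ _
      _ ≤ K * (‖gradient ψ y‖ * ‖A‖) :=
          mul_le_mul (hK y) (norm_cross_le _ _) (norm_nonneg _) hK0
      _ = K * ‖A‖ * ‖gradient ψ y‖ := by ring
  have h3 : ‖A‖ ^ 2 ≤ K * ‖A‖ * ∫ y, ‖fderiv ℝ ψ y‖ := by
    rw [h1, ← integral_const_mul]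
    have h4 : ‖∫ y, ⟪u y, curl (fun y => ψ y • A) y⟫‖ ≤ ∫ y, K * ‖A‖ * ‖fderiv ℝ ψ y‖ :=
      (norm_integral_le_integral_norm _).trans (integral_mono_of_nonneg
        (Eventually.of_forall fun y => norm_nonneg _) (hgi.const_mul _) (Eventually.of_forall h2))
    exact (Real.le_norm_self _).trans h4
  have hI0 : 0 ≤ ∫ y, ‖fderiv ℝ ψ y‖ := integral_nonneg fun y => norm_nonneg _
  by_cases hA0 : ‖A‖ = 0
  · rw [hA0]; positivity
  · have hApos : 0 < ‖A‖ := lt_of_le_of_ne (norm_nonneg _) (Ne.symm hA0)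
    have : ‖A‖ * ‖A‖ ≤ ‖A‖ * (K * ∫ y, ‖fderiv ℝ ψ y‖) := by nlinarith
    exact le_of_mul_le_mul_left this hApos

/-- The mass `∫ψ|ω|` is at most `∫ψ(|ω|‖e‖ + d) = ‖e‖ ∫ψ|ω| + d ∫ψ` under the mass clause of
`exists_refDirection_of_aligned`. [folklore] -/
theorem mass_le_of_refDirection {ω : (EuclideanSpace ℝ (Fin 3)) → (EuclideanSpace ℝ (Fin 3))} {S : Set (EuclideanSpace ℝ (Fin 3))} {d : ℝ} {e : (EuclideanSpace ℝ (Fin 3))} (hω : Continuous ω)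
    (hψc : Continuous ψ) (hψs : HasCompactSupport ψ) (hψ0 : ∀ y, 0 ≤ ψ y) (hsupp : support ψ ⊆ S)
    (he : ∀ y ∈ S, ‖ω y‖ ≤ ‖ω y‖ * ‖e‖ + d) :
    ∫ y, ψ y * ‖ω y‖ ≤ ‖e‖ * (∫ y, ψ y * ‖ω y‖) + d * ∫ y, ψ y := by
  have hi2 : Integrable (fun y => ψ y * ‖ω y‖) :=
    (hψc.mul hω.norm).integrable_of_hasCompactSupport hψs.mul_right
  have hi3 : Integrable ψ := hψc.integrable_of_hasCompactSupport hψs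
  have hpt : ∀ y, ψ y * ‖ω y‖ ≤ ‖e‖ * (ψ y * ‖ω y‖) + d * ψ y := by
    intro y
    by_cases hy : y ∈ support ψ
    · have h := he y (hsupp hy)
      nlinarith [hψ0 y]
    · rw [notMem_support] at hy
      simp [hy]
  calc ∫ y, ψ y * ‖ω y‖ ≤ ∫ y, (‖e‖ * (ψ y * ‖ω y‖) + d * ψ y) :=
        integral_mono hi2 ((hi2.const_mul _).add (hi3.const_mul _)) hpt
    _ = ‖e‖ * (∫ y, ψ y * ‖ω y‖) + d * ∫ y, ψ y := by
        rw [integral_add (hi2.const_mul _) (hi3.const_mul _), integral_const_mul, integral_const_mul]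

end Mass

end Summit.NavierStokesRegularity.FluidComputer

end
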